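import Literature.MathematicalPhysics.QuantumFieldTheory.Balaban1983to89.B13Sect1Arith

/-!
# `Balaban1983to89.B13Lemma1Eq130` — T. Bałaban, *Renormalization group approach to lattice gauge field theories.
II. Cluster expansions*, Commun. Math. Phys. **116** (1988) 1–22, doi:10.1007/bf01239022 [Balaban1988RG2Cluster]:
the **(I.3.7)-type half of Lemma 1** — the resummation p. 8 l. −8 – p. 9 l. 17 of the terms bounded by **(1.30)**,
through the scaling inequality (1.31) and (1.32), to *"again a bound of the form (1.29) for the considered sum, with
the last exponential replaced by exp(−(1 − 2δ)κd_k(Y))"* (p. 9), PROVED for the Y-sum as a FUNCTION on the space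
(1.34) from the located per-term and level inputs; its conclusion is LITERALLY the hypothesis `h129'` of
`B13Lemma1Assembly.lemma1Printed_of_sect1` / `bound136_of_129` (p403319), so that after this module Lemma 1
(1.33)–(1.36) rests on per-term inputs ((1.24), (1.30)) and printed counts for BOTH types of terms

statement-level skeleton of published theorems with citation tags; proofs where landed; nothing here is a claim about
the Yang–Mills mass gap

PDF held: `paper:balaban1988-cmp116-rg-ii-cluster` (journal page = PDF page + 0); p. 8 and p. 9 re-read this session AS
IMAGES from the renders `run/shared/lean/pub/pub-balaban/b2b-balaban-ref1/pages/1988-cmp116-rg-II-cluster/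
1988-cmp116-rg-II-cluster-p008-x2.png`, `…-p009-x2.png` (the display (1.30) straddles the page break; both halves
quoted below verbatim), and from the text layer (`lit read … --pages 1-11`).

CITATION HEADER (verbatim).  p. 8 [PDF 8] last paragraph: *"Consider now the expression (I.3.7), or rather its
analytic extension (I.3.15). It is determined by the functions H_j, (δ/δB)𝐇_j, besides the function 𝐇_k, and it
depends on the first two functions restricted to X. We introduce the parameters s in the same way as before, only the
family σ₀ is different. It is defined now as the family of all cubes Δ disjoint with the interior of X₀, where X₀ is
the smallest localization domain from 𝐃_k containing X. We apply the expansion (1.10). Terms in this expansion can be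
bounded using the inequalities (I.3.17), (1.21), and we obtain the bound*
  `E₀24B₀²C₁B₃e^{16κ₁}α₂⁻¹ε₁ exp(−½δ₀M(L^jη)⁻¹ − ½δ₀dist^{(ξ)}(X, □)) · exp(−(κ₁ − 1)M⁻⁴|Y∖X₀|) exp(−κd_j(X)).` (1.30)
p. 9 [PDF 9]: *"By the definition of the linear size functions they satisfy the following fundamental scaling
inequality* `d_j(X) ≥ (L^jη)⁻¹d_k(X₀).` (1.31) *It implies that the last two exponentials in (1.30) can be bounded by*
`exp(−(1 − δ)κd_k(Y) − δκd_j(X)),` (1.32) *if ¼(κ₁ − 1) ≥ (1 − δ)κ, 0 < δ < 1. Now we sum all the terms having the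
same localization domain Y. At first we notice that each term is defined and analytic on the corresponding space
(I.3.16) restricted to the domain Y. All these spaces contain the subspace U^c_{k+1}(Y, (1+β)α₀, (1+β)α₁, α₀), and all
the terms are defined and analytic on it. The summation over X is controlled in several steps. We fix a cube □′ ∈ π_j
such, that □′ ⊂ X, dist^{(ξ)}(X, □) = dist^{(ξ)}(□′, □), and we sum over X containing □′, using the second
exponential in (1.32), and the inequality (1.26) for δκ sufficiently large. Next we sum over the cubes □′, and this sum
is controlled by the first exponential in (1.30). The first term under the exponential gives also the factor L^jη,
which controls the sum over j. Finally, the sum over all possible cubes □ can be bounded by*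
  `M⁻⁴|Y| ≤ 3·2³d_k(Y) ≤ exp δκd_k(Y).`
*These estimates yield again a bound of the form (1.29) for the considered sum, with the last exponential replaced by
exp(−(1 − 2δ)κd_k(Y))."*

WHAT IS REPRODUCED (cell `pub-ymgap`, Track A node N10 = [B13], prover seat `pub-ymgap-dag-p2`, second module after
the T1 landing `B13Lemma1Assembly` p403319; a NEW LEAF importing `B13Sect1Arith` only — the sibling's kernel
certificates `bound_132` ((1.30) last two exponentials + (1.31) + G1 + R8 ⇒ (1.32)), `factor_Ljη` («the first term
under the exponential gives also the factor L^jη») and `jsum_le` are used BY NAME; nothing there is modified):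
* `jsum_le_two` — the j-sum *"which controls the sum over j"*: Σ_{j ≤ k} L^jη ≤ 2 (η = L^{−k}, L ≥ 2), from `jsum_le`.
* `gather_p9` — the NESTED-SUM BOOKKEEPING of p. 9 over abstract finite index sets, scalars: □ ∈ `Sc` (⊂ Y), j ≤ k,
  □′ ∈ `Sq □ j` (⊂ π_j), X ∈ `SX □ j □′` (X ∈ 𝐃_j, X ∋ □′), terms ≤ (1.30) with its last two exponentials already in the
  form (1.32); level bounds (1.26) at the rate δκ (`hX`), the □′-sum of exp(−½δ₀dist^{(ξ)}(□′, □)) ≤ O₂ (`hq`), the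
  factor L^jη (PROVED, `factor_Ljη`, threshold δ₀M ≥ 2/e), Σ_j L^jη ≤ 2 (PROVED), the outer inequality of the □-count
  #{□} ≤ exp δκd_k(Y) (`hc`) ⇒ the whole sum ≤ 2K′O(1)O₂·exp(−(1 − 2δ)κd_k(Y)) — EXACTLY the (1.29)-form with the last
  exponential replaced, every factor explicit (K′ = the (1.30) prefactor E₀24B₀²C₁B₃e^{16κ₁}α₂⁻¹ε₁).
* `boundP9_of_130` — the same for the Y-sum of the terms AS A FUNCTION on the space (1.34) over the record carrier
  `B13.StepData` (`‖Σ‖ ≤ Σ‖·‖`), from the per-term bound (1.30) VERBATIM (`h130`: first exponential, e^{−(κ₁−1)n},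
  e^{−κd_j(X)} with n = M⁻⁴|Y∖X₀|), (1.31) per term (`h131`), the geometric input G1′ of (1.32) d_k(Y) ≤ d_k(X₀) +
  4M⁻⁴|Y∖X₀| (`hG1`, cell census; `…TreeLength.adjoinLeaf_treeLen` /
  `TreeLengthTorusTransfer.torusTreeLen_le_card_sdiff_add` give coefficient 1), R8 «¼(κ₁ − 1) ≥ (1 − δ)κ», 0 ≤ κ,
  δ < 1, and the level inputs of `gather_p9`: conclusion
  `‖W₂ Y φ‖ ≤ (2K′O(1)O₂)·exp(−(1 − 2δ)κd_k(Y))` on `S.sp1 Y` = the hypothesis `h129'` of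
  `B13Lemma1Assembly.lemma1Printed_of_sect1` with `P₂ = 2K′O(1)O₂`.
WHAT ENTERS ONLY AS HYPOTHESES (by assertion or by reference in print; cell `pub-balaban` GAPS.md G-B13-01…05,
G-B13-07, C-B13-01): the per-term bound (1.30) itself ((I.3.17) of [I] and (1.21) ← [15] Prop. 4: by reference), (1.31)
(*"By the definition of the linear size functions"* — a property of [I]'s d_j across scales, not modelled by the
single-scale `Setup.LocDomainSys`), (1.26) at the rate δκ (*"for δκ sufficiently large"*; kernel for the cube geometry:
`…B12TreeDecay`, torus: `TreeLengthTorus.ineq126_torus`), the □′-sum constant O₂, and the OUTER inequality of the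
□-count (its printed inner step M⁻⁴|Y| ≤ 3·2³d_k(Y) is FALSE for degenerate domains, cell GAPS G-B13-07 — repaired
forms `B13Sect1Arith.bound_128_repaired`, `cubesum_p9`; the outer inequality is carried on the INDEX SET of the □ that
occur, p. 8: *"we sum over X with d_j(X) ≠ 0, as it follows from our inductive construction"*).  NO hypothesis has the
conclusion's rate (1 − 2δ)κ.  MODELLING CONVENTIONS (as `B13Sect1Arith`, `B13Lemma1Assembly`; cell DIVERGENCE
D-pv20.5): {□}, {□′}, {X} are abstract finite index sets carried with the printed level bounds (here {□′}, {X} keep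
their dependence on □); the per-term data d_j(X), d_k(X₀), M⁻⁴|Y∖X₀| ∈ ℕ, dist^{(ξ)}(□′, □) are abstract functions of
the indices; L^jη := L^j·(L^k)⁻¹.  HONEST FRAMING: a count-neutral Track-A side landing (YM-PLAN §1); NOT a discharge of
node N10; one finite T⁴ programme at fixed ε; nothing continuum / OS / mass-gap / Clay.
-/

noncomputable section

namespace Literature.MathematicalPhysics.QuantumFieldTheory.Balaban1983to89.B13Lemma1Eq130

open Literature.MathematicalPhysics.QuantumFieldTheory.Balaban1983to89

/-! ## §1. The j-sum and the scalar bookkeeping of p. 9 -/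

/-- p. 9 [PDF 9]: *"The first term under the exponential gives also the factor L^jη, which controls the sum over j"* —
the geometric j-sum Σ_{j=0}^{k} L^jη = Σ_{j ≤ k} L^{j−k} ≤ L/(L − 1) ≤ 2 for L ≥ 2 (η = L^{−k}); the sibling's `jsum_le`
(p. 8 *"the sum over j is bounded by 2(6L)⁴"*) divided by (6L)⁴. [cite: Balaban1988RG2Cluster, p.9 (the sum over j)] -/
theorem jsum_le_two {L : ℝ} (hL : 2 ≤ L) (k : ℕ) :
    ∑ j ∈ Finset.range (k + 1), L ^ j * (L ^ k)⁻¹ ≤ 2 := by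
  have h := B13Sect1Arith.jsum_le hL k
  rw [← Finset.mul_sum] at h
  have hpos : (0 : ℝ) < (6 * L) ^ 4 := by positivity
  nlinarith

/-- **p. 9, the resummation of the (I.3.7)-type terms — NESTED-SUM BOOKKEEPING over abstract finite index sets**
(scalars): □ ∈ `Sc`, j ∈ {0,…,k}, □′ ∈ `Sq □ j`, X ∈ `SX □ j □′`, terms bounded (`hT`) by the (1.30) prefactor `K'`
times the first exponential `exp(−½δ₀M(L^jη)⁻¹ − ½δ₀dist^{(ξ)}(□′, □))` times the (1.32)-form
`exp(−(1 − δ)κd_k(Y) − δκd_j(X))` of the last two; level bounds as the text states them: the X-sum by (1.26) at the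
rate δκ (`hX`: *"using the second exponential in (1.32), and the inequality (1.26) for δκ sufficiently large"*), the
□′-sum of the second term of the first exponential ≤ O₂ (`hq`: *"this sum is controlled by the first exponential in
(1.30)"*), the factor L^jη from its first term (PROVED: `B13Sect1Arith.factor_Ljη`, threshold δ₀M ≥ 2e⁻¹ — `ha`),
Σ_j L^jη ≤ 2 (PROVED: `jsum_le_two`, L ≥ 2), and the outer inequality of *"the sum over all possible cubes □ can be
bounded by M⁻⁴|Y| ≤ 3·2³d_k(Y) ≤ exp δκd_k(Y)"* (`hc`).  CONCLUSION: the whole sum ≤ 2K′O(1)O₂·exp(−(1 − 2δ)κd_k(Y))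
— *"a bound of the form (1.29) … with the last exponential replaced by exp(−(1 − 2δ)κd_k(Y))"*, every factor
explicit. [cite: Balaban1988RG2Cluster, p.9 (before Lemma 1)] -/
theorem gather_p9 {α γ δ : Type*} (Sc : Finset α) (k : ℕ) (Sq : α → ℕ → Finset γ) (SX : α → ℕ → γ → Finset δ)
    (T : α → ℕ → γ → δ → ℝ) (dist : α → ℕ → γ → ℝ) (dj : α → ℕ → γ → δ → ℝ)
    {K' O1 O₂ L δ₀ M δ κ d : ℝ} (hK' : 0 ≤ K') (hO1 : 0 ≤ O1) (hO₂ : 0 ≤ O₂) (hL : 2 ≤ L)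
    (ha : 2 * Real.exp (-1) ≤ δ₀ * M)
    (hT : ∀ c ∈ Sc, ∀ j ∈ Finset.range (k + 1), ∀ q ∈ Sq c j, ∀ x ∈ SX c j q,
      T c j q x ≤ K' * Real.exp (-(1 / 2) * (δ₀ * M) * (L ^ j * (L ^ k)⁻¹)⁻¹ - (1 / 2) * δ₀ * dist c j q) *
        Real.exp (-(1 - δ) * κ * d - δ * κ * dj c j q x))
    (hX : ∀ c ∈ Sc, ∀ j ∈ Finset.range (k + 1), ∀ q ∈ Sq c j,
      ∑ x ∈ SX c j q, Real.exp (-(δ * κ * dj c j q x)) ≤ O1)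
    (hq : ∀ c ∈ Sc, ∀ j ∈ Finset.range (k + 1), ∑ q ∈ Sq c j, Real.exp (-((1 / 2) * δ₀ * dist c j q)) ≤ O₂)
    (hc : (Sc.card : ℝ) ≤ Real.exp (δ * κ * d)) :
    ∑ c ∈ Sc, ∑ j ∈ Finset.range (k + 1), ∑ q ∈ Sq c j, ∑ x ∈ SX c j q, T c j q x
      ≤ 2 * K' * O1 * O₂ * Real.exp (-(1 - 2 * δ) * κ * d) := by
  -- abbreviations
  set ℓ : ℕ → ℝ := fun j => L ^ j * (L ^ k)⁻¹
  have hL0 : 0 < L := by linarith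
  have hℓpos : ∀ j, 0 < ℓ j := fun j => by positivity
  set A := Real.exp (-(1 - δ) * κ * d) with hA
  -- the per-term bound, factorised
  have hsplit : ∀ c j q x,
      K' * Real.exp (-(1 / 2) * (δ₀ * M) * (ℓ j)⁻¹ - (1 / 2) * δ₀ * dist c j q) *
          Real.exp (-(1 - δ) * κ * d - δ * κ * dj c j q x)
        = K' * A * Real.exp (-(1 / 2) * (δ₀ * M) * (ℓ j)⁻¹) * Real.exp (-((1 / 2) * δ₀ * dist c j q)) *
            Real.exp (-(δ * κ * dj c j q x)) := by
    intro c j q x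
    rw [hA]
    have e1 : Real.exp (-(1 / 2) * (δ₀ * M) * (ℓ j)⁻¹ - (1 / 2) * δ₀ * dist c j q)
        = Real.exp (-(1 / 2) * (δ₀ * M) * (ℓ j)⁻¹) * Real.exp (-((1 / 2) * δ₀ * dist c j q)) := by
      rw [← Real.exp_add]; ring_nf
    have e2 : Real.exp (-(1 - δ) * κ * d - δ * κ * dj c j q x)
        = Real.exp (-(1 - δ) * κ * d) * Real.exp (-(δ * κ * dj c j q x)) := by
      rw [← Real.exp_add]; ring_nf
    rw [e1, e2]; ring
  -- level X
  have hLX : ∀ c ∈ Sc, ∀ j ∈ Finset.range (k + 1), ∀ q ∈ Sq c j,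
      ∑ x ∈ SX c j q, T c j q x
        ≤ K' * A * Real.exp (-(1 / 2) * (δ₀ * M) * (ℓ j)⁻¹) * Real.exp (-((1 / 2) * δ₀ * dist c j q)) * O1 := by
    intro c hc' j hj q hq'
    calc ∑ x ∈ SX c j q, T c j q x
        ≤ ∑ x ∈ SX c j q, K' * A * Real.exp (-(1 / 2) * (δ₀ * M) * (ℓ j)⁻¹) *
            Real.exp (-((1 / 2) * δ₀ * dist c j q)) * Real.exp (-(δ * κ * dj c j q x)) :=
          Finset.sum_le_sum fun x hx => by rw [← hsplit]; exact hT c hc' j hj q hq' x hx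
      _ = K' * A * Real.exp (-(1 / 2) * (δ₀ * M) * (ℓ j)⁻¹) * Real.exp (-((1 / 2) * δ₀ * dist c j q)) *
            ∑ x ∈ SX c j q, Real.exp (-(δ * κ * dj c j q x)) := by rw [Finset.mul_sum]
      _ ≤ _ := mul_le_mul_of_nonneg_left (hX c hc' j hj q hq') (by positivity)
  -- level □′, with the factor L^jη from the first term (factor_Ljη)
  have hLq : ∀ c ∈ Sc, ∀ j ∈ Finset.range (k + 1),
      ∑ q ∈ Sq c j, ∑ x ∈ SX c j q, T c j q x ≤ K' * A * O1 * O₂ * ℓ j := by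
    intro c hc' j hj
    have hfac : Real.exp (-(1 / 2) * (δ₀ * M) * (ℓ j)⁻¹) ≤ ℓ j := B13Sect1Arith.factor_Ljη (hℓpos j) ha
    have hO₂' : ∑ q ∈ Sq c j, Real.exp (-((1 / 2) * δ₀ * dist c j q)) ≤ O₂ := hq c hc' j hj
    calc ∑ q ∈ Sq c j, ∑ x ∈ SX c j q, T c j q x
        ≤ ∑ q ∈ Sq c j, K' * A * Real.exp (-(1 / 2) * (δ₀ * M) * (ℓ j)⁻¹) *
            Real.exp (-((1 / 2) * δ₀ * dist c j q)) * O1 :=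
          Finset.sum_le_sum fun q hq' => hLX c hc' j hj q hq'
      _ = K' * A * O1 * Real.exp (-(1 / 2) * (δ₀ * M) * (ℓ j)⁻¹) *
            ∑ q ∈ Sq c j, Real.exp (-((1 / 2) * δ₀ * dist c j q)) := by
          rw [Finset.mul_sum]; refine Finset.sum_congr rfl fun q _ => by ring
      _ ≤ K' * A * O1 * ℓ j * O₂ :=
          mul_le_mul (mul_le_mul_of_nonneg_left hfac (by positivity)) hO₂'
            (Finset.sum_nonneg fun q _ => (Real.exp_pos _).le) (by positivity)
      _ = K' * A * O1 * O₂ * ℓ j := by ring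
  -- level j
  have hLj : ∀ c ∈ Sc,
      ∑ j ∈ Finset.range (k + 1), ∑ q ∈ Sq c j, ∑ x ∈ SX c j q, T c j q x ≤ K' * A * O1 * O₂ * 2 := by
    intro c hc'
    calc ∑ j ∈ Finset.range (k + 1), ∑ q ∈ Sq c j, ∑ x ∈ SX c j q, T c j q x
        ≤ ∑ j ∈ Finset.range (k + 1), K' * A * O1 * O₂ * ℓ j := Finset.sum_le_sum fun j hj => hLq c hc' j hj
      _ = K' * A * O1 * O₂ * ∑ j ∈ Finset.range (k + 1), ℓ j := by rw [Finset.mul_sum]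
      _ ≤ K' * A * O1 * O₂ * 2 := mul_le_mul_of_nonneg_left (jsum_le_two hL k) (by positivity)
  -- level □ and the exponent bookkeeping δκd − (1 − δ)κd = −(1 − 2δ)κd
  calc ∑ c ∈ Sc, ∑ j ∈ Finset.range (k + 1), ∑ q ∈ Sq c j, ∑ x ∈ SX c j q, T c j q x
      ≤ Sc.card * (K' * A * O1 * O₂ * 2) := B13Sect1Arith.sum_le_card_mul _ _ _ hLj
    _ ≤ Real.exp (δ * κ * d) * (K' * A * O1 * O₂ * 2) := mul_le_mul_of_nonneg_right hc (by positivity)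
    _ = 2 * K' * O1 * O₂ * (Real.exp (δ * κ * d) * A) := by ring
    _ = 2 * K' * O1 * O₂ * Real.exp (-(1 - 2 * δ) * κ * d) := by
        rw [hA, ← Real.exp_add]; ring_nf

/-! ## §2. The (I.3.7)-type Y-sum as a function on the space (1.34): (1.30), (1.31), (1.32) ⇒ the p. 9 bound -/

/-- **(1.30) + (1.31) + (1.32) + the p. 9 level sums ⇒ the p. 9 bound for the Y-sum of the (I.3.7)-type terms AS A
FUNCTION on the space (1.34)** over the record carrier `B13.StepData`: with the terms `T Y □ j □′ X : Φ → ℂ` of the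
expansion (1.10) applied to (I.3.15), indexed for fixed Y by the cubes □ ⊂ Y (`Sc Y`), the scales j ≤ k, the cubes
□′ ∈ π_j with dist^{(ξ)}(X, □) = dist^{(ξ)}(□′, □) (`Sq Y □ j`) and the domains X ∈ 𝐃_j, X ∋ □′ (`SX Y □ j □′`), GIVEN:
the per-term bound **(1.30)** VERBATIM on `S.sp1 Y` (`h130`; K′ = E₀24B₀²C₁B₃e^{16κ₁}α₂⁻¹ε₁, `n` = M⁻⁴|Y∖X₀|,
`dX0` = d_k(X₀), `dj` = d_j(X) ≥ 0 (`hdj`)); **(1.31)** per term (`h131`); the geometric input G1′ behind (1.32),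
d_k(Y) ≤ d_k(X₀) + 4M⁻⁴|Y∖X₀| (`hG1`); R8 *"if ¼(κ₁ − 1) ≥ (1 − δ)κ, 0 < δ < 1"* (`hR8`, `hδ1`; and 0 ≤ κ); L ≥ 2;
δ₀M ≥ 2e⁻¹ (the implicit threshold of `B13Sect1Arith.factor_Ljη`, implied by R24 κ ≤ δ₀M once κ ≥ 1); and the level
inputs (1.26) at the rate δκ (`h126`), the □′-sum ≤ O₂ (`hq`), the outer □-count (`hc`).  CONCLUSION: on `S.sp1 Y`,
`‖(Σ_□ Σ_j Σ_□′ Σ_X T)(φ)‖ ≤ (2K′O(1)O₂)·exp(−(1 − 2δ)κd_k(Y))` — LITERALLY the hypothesis `h129'` of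
`B13Lemma1Assembly.lemma1Printed_of_sect1` / `bound136_of_129` with `W₂ Y := Σ_□ Σ_j Σ_□′ Σ_X T Y □ j □′ X` and
`P₂ := 2K′O(1)O₂`.  Kernel: (1.32) by `B13Sect1Arith.bound_132`, then `gather_p9`.
[cite: Balaban1988RG2Cluster, (1.30)–(1.32) pp.8–9] -/
theorem boundP9_of_130 (S : B13.StepData) (c : B13.Consts) {α γ δ : Type*} (Sc : S.Dk.Dom → Finset α) (k : ℕ)
    (Sq : S.Dk.Dom → α → ℕ → Finset γ) (SX : S.Dk.Dom → α → ℕ → γ → Finset δ)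
    (T : (Y : S.Dk.Dom) → α → ℕ → γ → δ → S.Φ → ℂ) (dist : S.Dk.Dom → α → ℕ → γ → ℝ)
    (dj dX0 : S.Dk.Dom → α → ℕ → γ → δ → ℝ) (n : S.Dk.Dom → α → ℕ → γ → δ → ℕ) {K' O1 O₂ : ℝ}
    (hK' : 0 ≤ K') (hO1 : 0 ≤ O1) (hO₂ : 0 ≤ O₂) (hL : 2 ≤ (c.L : ℝ)) (hκ : 0 ≤ c.κ) (hδ1 : c.δ < 1)
    (hR8 : (1 - c.δ) * c.κ ≤ (1 / 4) * (c.κ₁ - 1)) (hδ₀M : 2 * Real.exp (-1) ≤ c.δ₀ * c.M)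
    (h130 : ∀ Y φ, φ ∈ S.sp1 Y → ∀ a ∈ Sc Y, ∀ j ∈ Finset.range (k + 1), ∀ q ∈ Sq Y a j, ∀ x ∈ SX Y a j q,
      ‖T Y a j q x φ‖ ≤ K' * Real.exp (-(1 / 2) * (c.δ₀ * c.M) * ((c.L : ℝ) ^ j * ((c.L : ℝ) ^ k)⁻¹)⁻¹
          - (1 / 2) * c.δ₀ * dist Y a j q) *
        Real.exp (-(c.κ₁ - 1) * (n Y a j q x : ℝ)) * Real.exp (-(c.κ * dj Y a j q x)))
    (hdj : ∀ Y a j q x, 0 ≤ dj Y a j q x)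
    (h131 : ∀ Y, ∀ a ∈ Sc Y, ∀ j ∈ Finset.range (k + 1), ∀ q ∈ Sq Y a j, ∀ x ∈ SX Y a j q,
      dX0 Y a j q x ≤ ((c.L : ℝ) ^ j * ((c.L : ℝ) ^ k)⁻¹) * dj Y a j q x)
    (hG1 : ∀ Y, ∀ a ∈ Sc Y, ∀ j ∈ Finset.range (k + 1), ∀ q ∈ Sq Y a j, ∀ x ∈ SX Y a j q,
      S.Dk.dj Y ≤ dX0 Y a j q x + 4 * (n Y a j q x : ℝ))
    (h126 : ∀ Y, ∀ a ∈ Sc Y, ∀ j ∈ Finset.range (k + 1), ∀ q ∈ Sq Y a j,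
      ∑ x ∈ SX Y a j q, Real.exp (-(c.δ * c.κ * dj Y a j q x)) ≤ O1)
    (hq : ∀ Y, ∀ a ∈ Sc Y, ∀ j ∈ Finset.range (k + 1),
      ∑ q ∈ Sq Y a j, Real.exp (-((1 / 2) * c.δ₀ * dist Y a j q)) ≤ O₂)
    (hc : ∀ Y, ((Sc Y).card : ℝ) ≤ Real.exp (c.δ * c.κ * S.Dk.dj Y)) :
    ∀ Y φ, φ ∈ S.sp1 Y →
      ‖(∑ a ∈ Sc Y, ∑ j ∈ Finset.range (k + 1), ∑ q ∈ Sq Y a j, ∑ x ∈ SX Y a j q, T Y a j q x) φ‖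
        ≤ 2 * K' * O1 * O₂ * Real.exp (-(1 - 2 * c.δ) * c.κ * S.Dk.dj Y) := by
  intro Y φ hφ
  have hL1 : (1 : ℝ) ≤ c.L := by linarith
  have hLk : (0 : ℝ) < (c.L : ℝ) ^ k := by positivity
  -- (1.30) ⇒ the (1.32)-form per-term bound
  have hT : ∀ a ∈ Sc Y, ∀ j ∈ Finset.range (k + 1), ∀ q ∈ Sq Y a j, ∀ x ∈ SX Y a j q,
      ‖T Y a j q x φ‖ ≤ K' * Real.exp (-(1 / 2) * (c.δ₀ * c.M) * ((c.L : ℝ) ^ j * ((c.L : ℝ) ^ k)⁻¹)⁻¹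
          - (1 / 2) * c.δ₀ * dist Y a j q) *
        Real.exp (-(1 - c.δ) * c.κ * S.Dk.dj Y - c.δ * c.κ * dj Y a j q x) := by
    intro a ha j hj q hq' x hx
    have hjk : j ≤ k := Nat.lt_succ_iff.mp (Finset.mem_range.mp hj)
    have hℓ1 : (c.L : ℝ) ^ j * ((c.L : ℝ) ^ k)⁻¹ ≤ 1 := by
      rw [mul_inv_le_iff₀ hLk, one_mul]
      exact pow_le_pow_right₀ hL1 hjk
    have h132 := B13Sect1Arith.bound_132 (n := (n Y a j q x : ℝ)) hκ hδ1 hR8 hℓ1 (hdj Y a j q x)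
      (h131 Y a ha j hj q hq' x hx) (Nat.cast_nonneg _) (hG1 Y a ha j hj q hq' x hx)
    calc ‖T Y a j q x φ‖ ≤ _ := h130 Y φ hφ a ha j hj q hq' x hx
      _ = K' * Real.exp (-(1 / 2) * (c.δ₀ * c.M) * ((c.L : ℝ) ^ j * ((c.L : ℝ) ^ k)⁻¹)⁻¹
            - (1 / 2) * c.δ₀ * dist Y a j q) *
          (Real.exp (-(c.κ₁ - 1) * (n Y a j q x : ℝ)) * Real.exp (-(c.κ * dj Y a j q x))) := by ring
      _ ≤ _ := mul_le_mul_of_nonneg_left h132 (by positivity)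
  have hgather := gather_p9 (Sc Y) k (Sq Y) (SX Y) (fun a j q x => ‖T Y a j q x φ‖) (dist Y) (dj Y)
    (d := S.Dk.dj Y) hK' hO1 hO₂ hL hδ₀M hT (h126 Y) (hq Y) (hc Y)
  refine le_trans ?_ hgather
  simp only [Finset.sum_apply]
  refine (norm_sum_le _ _).trans (Finset.sum_le_sum fun a _ => ?_)
  refine (norm_sum_le _ _).trans (Finset.sum_le_sum fun j _ => ?_)
  refine (norm_sum_le _ _).trans (Finset.sum_le_sum fun q _ => ?_)
  exact norm_sum_le _ _

end Literature.MathematicalPhysics.QuantumFieldTheory.Balaban1983to89.B13Lemma1Eq130
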